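import Mathlib.NumberTheory.NumberField.Basic
import Mathlib.Analysis.Meromorphic.Basic
import Mathlib.RepresentationTheory.Irreducible
import Mathlib.RepresentationTheory.Subrepresentation
import Literature.AlgebraicGeometry.Motives.HasseWeil
import Literature.AlgebraicGeometry.Motives.ZetaFunction
import Literature.NumberTheory.GaloisRepresentations.PAdicHodge
import HarnessLib

-- provenance: harness21/H21/H21/Statements/Lang/HasseWeil.lean @ 62d5d39 (interim HEAD d8f2665); M5 mechanical rewrite
/-!
# Langlands family (`lang`): Hasse–Weil L-functions, good reduction and Fontaine–Mazur
(statements **lang.S31**, **lang.S06**, **lang.S32**, **lang.S35**)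

Trunk T-MOTIVE / MotiveL, OUTLINE §3 (`Statements/Lang/HasseWeil.lean`). Throughout `K : Type`
is a number field (universe `0` is forced by the Betti side `BettiHodgeData ℂ`, OUTLINE §1(a)),
`E ℓ : EtaleRealization K ℓ` is a family of `ℓ`-adic étale realizations (hypothesis structure,
prelude C5), `Bℂ : BettiHodgeData ℂ` is Betti–Hodge data and `S : ArchSignData K` is the
archimedean sign data `h^{p,+}` (prelude C7; needed to pin Serre's `Γ`-factor at real places).

* **lang.S31** (Serre 1970, §§2–4; Deligne 1974): the *Hasse–Weil data* of `Hⁱ(X)` —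
  `Hⁱ_ℓ` as a `Γ_K`-representation (`EtaleRealization.galoisRep`), the local factor
  `P_v(T) = det(1 - F_v T | (Hⁱ_ℓ)^{I_v})` (`EtaleRealization.localEulerFactorAt`, geometric
  Frobenius), the conductor exponent (`GaloisRep.artinConductorExponent`) and Serre's
  `Γ`-factor (`HasseWeilData.gammaFactor`) — restated as definitional theorems about the
  accepted prelude C7 objects: `localEulerFactorAt_eq_of_isGeomFrobAt`, `isHasseWeilDataFor_iff`,
  `gammaFactor_def`, `conductor_def`, `hasMeromorphicContinuation_iff_exists_meromorphic`.
* **lang.S06** (Serre 1970, §4.1, conjectures C₉–C₁₀; Langlands): `HasseWeilConjecture E Bℂ S` —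
  for every smooth projective `X/K`, every `0 ≤ i ≤ 2 dim X` and every numeric datum `D`
  matching `Hⁱ(X)`, `L(D, s)` continues meromorphically and `Λ(s) = ε Λ(i + 1 - s)`, `|ε| = 1`.
* **lang.S32** (Deligne, *Weil I* (1974), Thm. 1.6; *Weil II* (1980), 3.3.9; SGA 4 XVI):
  `exists_isWeilFactorization_reductionAt` (the special fiber of a smooth proper model of a
  smooth projective variety satisfies the Weil conjectures — a named fact, D-0014),
  and the *statements* `GoodReductionCompatibility E` (unramifiedness and
  `P_v(Hⁱ_ℓ(X), T) = P_i(X̄_v, T)` at places of good reduction `v ∤ ℓ`, i.e. smooth proper base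
  change + Lefschetz trace formula for the hypothesis structure `E`) and
  `EllIndependenceStatement E` (`ℓ`-independence, integrality and purity of `P_v(Hⁱ_ℓ)`).
* **lang.S35** (Fontaine–Mazur 1995, Conjecture 1): `ComesFromGeometry E ρ` (`ρ` is a
  subquotient of some `Hⁱ_ℓ(X)(j)`) and `FontaineMazurConjecture E 𝔅`.

## Frobenius conventions

As in the prelude (`Literature.Prelude.MotiveL.HasseWeil`, OUTLINE §1(d)): the local factors here use
the **geometric** Frobenius (`Literature.NumberTheory.GaloisRepresentations.IsGeomFrobAt`, `GaloisRep.geomEulerFactorAt`), while the G09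
objects `GaloisRep.frobCharpoly`, `ArtinRep.eulerFactorAt` use the **arithmetic** Frobenius.
**No lemma relating `localEulerFactorAt` to `GaloisRep.frobCharpoly` (or its reverse) is
stated**: such an identity is false in general (the two are the reverse characteristic
polynomials of `ρ(σ⁻¹)` and `ρ(σ)` respectively and agree only after dualising).

## Mathlib search

Mathlib (this pin) has `Representation.IsIrreducible` (`RepresentationTheory/Irreducible.lean`),
`Subrepresentation` with `Subrepresentation.toRepresentation`
(`RepresentationTheory/Subrepresentation.lean`), `Representation.quotient`
(`RepresentationTheory/Basic.lean`) and equivariant linear equivalences `Representation.Equiv`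
(`RepresentationTheory/Intertwining.lean`), all used here for "subquotient"; `Meromorphic`,
`NumberField`, `Padic`. It has no Hasse–Weil L-function of a variety, no Weil conjectures for
varieties, no Fontaine–Mazur conjecture and no notion of subquotient of a representation
(`rg -i 'subquotient' Mathlib/RepresentationTheory` has no hits); `subquotientRep` below is a
two-line combination of `Subrepresentation.toRepresentation` and `Representation.quotient`.

## Design choices

* `localEulerFactorAt_eq_of_isGeomFrobAt` is proved from the prelude named fact
  `GaloisRep.geomEulerFactorAt_spec`, taken as a hypothesis `h` (D-0014). Likewise
  `isHasseWeilDataFor_iff` and `HasseWeilConjecture` take the named fact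
  `hbc : IsSmoothProjective.baseChangeHom (k := K) (L := ℂ)` that the prelude's
  `IsHasseWeilDataFor` now requires (M5 downstream note of `Motives/HasseWeil`).
* `exists_isWeilFactorization_reductionAt` carries `hX : IsSmoothProjective n X`: the clauses
  `P₀ = 1 - T`, `P_{2n} = 1 - qⁿ T` of `IsWeilFactorization` need the special fiber to be
  geometrically irreducible, which follows from geometric irreducibility of the generic fiber
  (prelude `IntegralModel.geometricallyIrreducible_reductionAt`) but fails for an arbitrary
  smooth proper `𝒳` (e.g. `𝒳 = Spec R ⊔ Spec R`). Finiteness of `κ(v)` is an instance.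
* In `GoodReductionCompatibility` the Weil factorization `P` is universally quantified; it is
  unique when it exists (the `P_i` have `P_i(0) = 1` and roots of pairwise distinct absolute
  values `q^{-i/2}`), so `∀` is harmless. The degree index is `i : Fin (2 * n + 1)` as in
  `IsWeilFactorization`.
* `EllIndependenceStatement` records both halves of Deligne's Thm. 1.6 as quoted in the
  inventory text of lang.S32 (integrality/`ℓ`-independence **and** purity of the reciprocal
  roots) at places of good reduction (`HasGoodReductionAt`).
* `ComesFromGeometry`/`FontaineMazurConjecture` use `ℚ_ℓ`-coefficients (`GaloisRep K ℚ_[ℓ] M`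
  and `Hⁱ_ℓ(X)(j) = (E ℓ).galoisRepTwist X i j`), whereas Fontaine–Mazur state Conjecture 1 for
  `ℚ̄_ℓ`-representations; this is the deviation forced by the accepted `EtaleRealization`
  (coefficients `ℚ_[ℓ]`) and is recorded here. "Geometric" is the accepted G09 predicate
  `GaloisRep.IsGeometric 𝔅 ρ` (unramified almost everywhere and de Rham at `v ∣ ℓ` relative to
  period-ring data `𝔅`, `Prelude/GalRep/PAdicHodge.lean`), whose universe pattern
  (`PeriodRingData.{0, 0, 0, w}` for `K : Type`) is copied.

## References

* J.-P. Serre, *Facteurs locaux des fonctions zêta des variétés algébriques (définitions et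
  conjectures)*, Sém. Delange–Pisot–Poitou 11 (1969/70), exp. 19, §§2–4.
* P. Deligne, *La conjecture de Weil. I*, Publ. Math. IHÉS 43 (1974), Thm. 1.6; *II*, Publ.
  Math. IHÉS 52 (1980), Cor. 3.3.9.
* M. Artin, A. Grothendieck, J.-L. Verdier, SGA 4, Exp. XVI (smooth and proper base change).
* J.-M. Fontaine, B. Mazur, *Geometric Galois representations*, in: Elliptic curves, modular
  forms & Fermat's last theorem (Hong Kong 1993), Int. Press (1995), §1, Conjecture 1.
* R. P. Langlands, *L-functions and automorphic representations*, ICM Helsinki 1978.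
-/

universe w w'

open scoped NumberField Polynomial
open Field IsDedekindDomain IsDedekindDomain.HeightOneSpectrum Module NumberField

noncomputable section

namespace Literature.NumberTheory.Automorphic

variable {K : Type} [Field K] [NumberField K]

/-! ### lang.S31: Hasse–Weil data (definitional theorems) -/

section HasseWeilData

variable {ℓ : ℕ} [Fact ℓ.Prime]

/-- **lang.S31** (local factor; Serre 1970, §2.2: `P_v(T) = det(1 - F_v T | (Hⁱ_ℓ)^{I_v})`;
Deligne 1974). For *every* prime `𝔓` of `\bar ℤ_K` above `v` and *every* geometric Frobenius
`σ` at `𝔓` (with `(Hⁱ_ℓ)^{I_𝔓}` finite-dimensional), the local Euler factor of the étale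
realization in degree `i` at `v` is the reverse characteristic polynomial of `σ` acting on the
inertia invariants `(Hⁱ_ℓ(X))^{I_𝔓}`. From the prelude named fact
`h : (E.galoisRep X i).geomEulerFactorAt_spec` (independence of the choices, D-0014);
deliberately *not* related to `GaloisRep.frobCharpoly` (arithmetic Frobenius), see the module
docstring. [cite: Serre1970, §2.2] -/
theorem localEulerFactorAt_eq_of_isGeomFrobAt (E : Literature.AlgebraicGeometry.Motives.EtaleRealization K ℓ) (X : Literature.AlgebraicGeometry.Motives.SchemeOver K)
    (i : ℕ) (h : (E.galoisRep X i).geomEulerFactorAt_spec)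
    {v : HeightOneSpectrum (𝓞 K)} {𝔓 : Ideal (GaloisRepresentations.absIntegers (𝓞 K) K)}
    (h𝔓 : 𝔓 ∈ v.primesAbove) {σ : absoluteGaloisGroup K} (hσ : GaloisRepresentations.IsGeomFrobAt (𝓞 K) σ 𝔓)
    [Module.Finite ℚ_[ℓ]
      ((E.galoisRep X i).fixedSubmodule (𝔓.inertia (absoluteGaloisGroup K)))] :
    E.localEulerFactorAt X i v =
      ((E.galoisRep X i).restrictInertiaInvariants 𝔓
        ⟨σ, by haveI := h𝔓.1; exact hσ.mem_decompositionSubgroup⟩).charpoly.reverse :=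
  h h𝔓 hσ

/-- **lang.S31** (matching predicate, unfolded; Serre 1970, §§2–4). `D` is the Hasse–Weil
datum of `Hⁱ(X)` iff: its weight is `i`; its rank is `dim Hⁱ_ℓ(X)` for every `ℓ`; for every
`ℓ` and every `v ∤ ℓ` its local factor maps to `det(1 - F_v T | Hⁱ_ℓ(X)^{I_v})` and its
conductor exponent is the Artin conductor exponent of `Hⁱ_ℓ(X)` at `v`; and at the place of
each `σ : K →+* ℂ` its Hodge numbers are those of the Hodge structure on `Hⁱ(X_σ)`, and at
real places its `F_∞`-signs `h^{p,+}` are those of the archimedean sign data `S`. The named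
fact `hbc : IsSmoothProjective.baseChangeHom` (`BaseChange.lean`) supplies the smoothness
witness `hbc σ hX` of `X_σ`, as in the prelude's `IsHasseWeilDataFor`. [cite: Serre1970, §§2–4] -/
theorem isHasseWeilDataFor_iff (hbc : Literature.AlgebraicGeometry.Motives.IsSmoothProjective.baseChangeHom (k := K) (L := ℂ))
    (E : ∀ (ℓ : ℕ) [Fact ℓ.Prime], Literature.AlgebraicGeometry.Motives.EtaleRealization K ℓ)
    (Bℂ : Literature.AlgebraicGeometry.Motives.BettiHodgeData ℂ) (S : Literature.AlgebraicGeometry.Motives.ArchSignData K) {n : ℕ} (X : Literature.AlgebraicGeometry.Motives.SchemeOver K)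
    (hX : Literature.AlgebraicGeometry.Motives.IsSmoothProjective n X) (i : ℕ) (D : Literature.AlgebraicGeometry.Motives.HasseWeilData K) :
    Literature.AlgebraicGeometry.Motives.IsHasseWeilDataFor hbc E Bℂ S X hX i D ↔
      D.weight = i ∧
      (∀ (ℓ : ℕ) [Fact ℓ.Prime], D.rank = finrank ℚ_[ℓ] ((E ℓ).V X i)) ∧
      (∀ (ℓ : ℕ) [Fact ℓ.Prime] (v : HeightOneSpectrum (𝓞 K)), (ℓ : 𝓞 K) ∉ v.asIdeal →
        (D.localFactor v).map (Int.castRingHom ℚ_[ℓ]) = (E ℓ).localEulerFactorAt X i v ∧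
          D.conductorExp v = GaloisRepresentations.GaloisRep.artinConductorExponent v ((E ℓ).galoisRep X i)) ∧
      (∀ (σ : K →+* ℂ) (p q : ℤ), (D.gammaData (InfinitePlace.mk σ)).hodge (p, q) =
        (Bℂ.hodge (hbc σ hX) i).hodgeNumber p q) ∧
      ∀ σ : K →+* ℂ, (InfinitePlace.mk σ).IsReal →
        ∀ p : ℤ, (D.gammaData (InfinitePlace.mk σ)).hPlus p = S.hPlus σ hX i p :=
  Iff.rfl

/-- **lang.S31** (Serre's `Γ`-factor; Serre 1970, §3.2–3.3, (25)–(27)). The archimedean factor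
of a Hasse–Weil datum is the product over the infinite places `w` of `K` of Serre's real
`Γ`-factor (built from `h^{p,q}`, `p < q`, and the `F_∞`-signs `h^{p,±}`) at real `w` and of
Serre's complex `Γ`-factor at complex `w`. [cite: Serre1970, §3.2–3.3  (25] -/
theorem gammaFactor_def (D : Literature.AlgebraicGeometry.Motives.HasseWeilData K) (s : ℂ) :
    D.gammaFactor s =
      open scoped Classical in
      ∏ w : InfinitePlace K, if w.IsReal then (D.gammaData w).gammaFactorReal s
        else (D.gammaData w).gammaFactorComplex s :=
  rfl

/-- **lang.S31** (conductor; Serre 1970, §2.1 and §4.1 (28): `N = ∏_v N v^{f(v)}`). [cite: Serre1970, §2.1 and §4.1 (28] -/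
theorem conductor_def (D : Literature.AlgebraicGeometry.Motives.HasseWeilData K) :
    D.conductor = ∏ᶠ v : HeightOneSpectrum (𝓞 K), v.residueCard ^ D.conductorExp v :=
  rfl

/-- **lang.S31** (meromorphic continuation, unfolded; Serre 1970, §4.1, C₉). `D` has meromorphic
continuation iff some function meromorphic on all of `ℂ` (Mathlib `Meromorphic`) agrees with
the weight-shifted L-series `s ↦ L(D, s + w/2)` on its half-plane of convergence `re s > 1`
(the accepted G09 predicate `LFunction.HasMeromorphicContinuation`; the one-level unfolding is
the prelude's `HasseWeilData.hasMeromorphicContinuation_iff`). [cite: Serre1970, §4.1  C₉] -/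
theorem hasMeromorphicContinuation_iff_exists_meromorphic (D : Literature.AlgebraicGeometry.Motives.HasseWeilData K) :
    D.HasMeromorphicContinuation ↔
      ∃ g : ℂ → ℂ, Meromorphic g ∧
        ∀ s : ℂ, 1 < s.re → g s = D.LSeries (s + (D.weight : ℂ) / 2) :=
  Iff.rfl

end HasseWeilData

/-! ### lang.S06: the Hasse–Weil conjecture -/

/-- **lang.S06** (Hasse–Weil conjecture; Serre 1970, §4.1, conjectures C₉–C₁₀; Langlands 1978).
For every smooth projective variety `X` of dimension `n` over the number field `K`, every degree
`0 ≤ i ≤ 2n` and every numeric Hasse–Weil datum `D` matching `Hⁱ(X)` (w.r.t. the étale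
realizations `E ℓ`, Betti–Hodge data `Bℂ` and archimedean sign data `S`, prelude
`IsHasseWeilDataFor`; all matching `D` share `LSeries`, `conductor` and `gammaFactor`), the
L-series `L(D, s) = L(Hⁱ(X), s)` has
meromorphic continuation to `ℂ` and the completed L-function
`Λ(s) = A^{s/2} Γ(Hⁱ, s) L(Hⁱ, s)` satisfies `Λ(s) = ε Λ(i + 1 - s)` for some `ε` with `|ε| = 1`.
An open conjecture: stated as a `Prop`; relative to the named fact
`hbc : IsSmoothProjective.baseChangeHom` through which `IsHasseWeilDataFor` reads the Hodge
numbers of `X_σ`. [cite: Serre1970, §4.1  conjectures C₉–C₁₀] -/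
def HasseWeilConjecture (hbc : Literature.AlgebraicGeometry.Motives.IsSmoothProjective.baseChangeHom (k := K) (L := ℂ))
    (E : ∀ (ℓ : ℕ) [Fact ℓ.Prime], Literature.AlgebraicGeometry.Motives.EtaleRealization K ℓ)
    (Bℂ : Literature.AlgebraicGeometry.Motives.BettiHodgeData ℂ) (S : Literature.AlgebraicGeometry.Motives.ArchSignData K) : Prop :=
  ∀ ⦃n : ℕ⦄ ⦃X : Literature.AlgebraicGeometry.Motives.SchemeOver K⦄ (hX : Literature.AlgebraicGeometry.Motives.IsSmoothProjective n X) (i : ℕ), i ≤ 2 * n →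
    ∀ D : Literature.AlgebraicGeometry.Motives.HasseWeilData K, Literature.AlgebraicGeometry.Motives.IsHasseWeilDataFor hbc E Bℂ S X hX i D →
      D.HasMeromorphicContinuation ∧ ∃ ε : ℂ, ‖ε‖ = 1 ∧ D.SatisfiesFunctionalEquation ε

/-! ### lang.S32: Weil conjectures for the reduction, good-reduction compatibility,
`ℓ`-independence -/

section GoodReduction

/-- **lang.S32** (Weil conjectures for the special fiber; Deligne, *Weil I* (1974), Thm. 1.6 and
*Weil II* (1980), Cor. 3.3.9; Grothendieck's rationality and functional equation, SGA 5).
Let `X` be a smooth projective variety of dimension `n` over the number field `K` and `𝒳` a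
smooth proper model of `X` over the local ring `𝓞_{K,v}` at the finite place `v`. Then the zeta
function `Z(X̄_v, T) ∈ ℚ⟦T⟧` of the reduction `X̄_v = 𝒳 ×_{𝓞_{K,v}} κ(v)` (a smooth proper,
geometrically irreducible variety of dimension `n` over the finite field `κ(v)` with
`q_v = v.residueCard` elements) admits a Weil factorization
`Z = ∏ P_{2k+1} / ∏ P_{2k}` with `P_i ∈ ℤ[T]`, `P_i(0) = 1`, `P₀ = 1 - T`, `P_{2n} = 1 - q_vⁿ T`
and all reciprocal roots of `P_i` of absolute value `q_v^{i/2}` (`Literature.AlgebraicGeometry.Motives.IsWeilFactorization`).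
The hypothesis `hX` supplies geometric irreducibility of the special fiber
(`IntegralModel.geometricallyIrreducible_reductionAt`); see the module docstring. Named fact
(D-0014), not proved here: the smoothness witnesses `hX`, `h𝒳` are parameters of the fact. [cite: Deligne1974, Thm. 1.6] -/
def exists_isWeilFactorization_reductionAt {n : ℕ} {X : Literature.AlgebraicGeometry.Motives.SchemeOver K}
    (_hX : Literature.AlgebraicGeometry.Motives.IsSmoothProjective n X) (v : HeightOneSpectrum (𝓞 K))
    (𝒳 : Literature.AlgebraicGeometry.Motives.IntegralModel (valuationSubringAtPrime K v) K X) (_h𝒳 : 𝒳.IsSmoothProper n) : Prop :=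
  ∃ P : Fin (2 * n + 1) → ℤ[X],
    Literature.AlgebraicGeometry.Motives.IsWeilFactorization v.residueCard n (Literature.AlgebraicGeometry.Motives.zetaSeries 𝒳.reductionAt) P

variable {ℓ : ℕ} [Fact ℓ.Prime]

/-- **lang.S32** (good-reduction compatibility of an étale realization; SGA 4, Exp. XVI
(smooth and proper base change) with the Lefschetz trace formula, SGA 4½ [Rapport]; Deligne
1974, Thm. 1.6). The statement, for the hypothesis structure `E : EtaleRealization K ℓ`, that at
every finite place `v ∤ ℓ` where the smooth projective `X` has a smooth proper model `𝒳` over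
`𝓞_{K,v}`: (a) `Hⁱ_ℓ(X)` is unramified at `v` (`GaloisRep.IsUnramifiedAt`), and (b) the local
Euler factor `det(1 - F_v T | Hⁱ_ℓ(X))` is the `i`-th polynomial `P_i(X̄_v, T)` of the Weil
factorization of `Z(X̄_v, T)` (which exists by `exists_isWeilFactorization_reductionAt` and is
unique, so the universal quantifier over `P` is harmless). This is a property the intended model
`X ↦ H•_ét(X_{K̄}, ℚ_ℓ)` has; it is *not* a consequence of the axioms of `EtaleRealization`. [folklore] -/
def GoodReductionCompatibility (E : Literature.AlgebraicGeometry.Motives.EtaleRealization K ℓ) : Prop :=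
  ∀ ⦃n : ℕ⦄ ⦃X : Literature.AlgebraicGeometry.Motives.SchemeOver K⦄, Literature.AlgebraicGeometry.Motives.IsSmoothProjective n X →
    ∀ (i : Fin (2 * n + 1)) (v : HeightOneSpectrum (𝓞 K)), (ℓ : 𝓞 K) ∉ v.asIdeal →
      ∀ 𝒳 : Literature.AlgebraicGeometry.Motives.IntegralModel (valuationSubringAtPrime K v) K X, 𝒳.IsSmoothProper n →
        (E.galoisRep X i).IsUnramifiedAt v ∧
          ∀ P : Fin (2 * n + 1) → ℤ[X],
            Literature.AlgebraicGeometry.Motives.IsWeilFactorization v.residueCard n (Literature.AlgebraicGeometry.Motives.zetaSeries 𝒳.reductionAt) P →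
              E.localEulerFactorAt X i v = (P i).map (Int.castRingHom ℚ_[ℓ])

/-- **lang.S32** (`ℓ`-independence, integrality and purity; Deligne, *Weil I* (1974),
Thm. 1.6). The statement, for a family of étale realizations `E ℓ`, that for `X` smooth
projective of dimension `n` over `K` with good reduction at `v` and every degree `i`, there is
a polynomial `P_v ∈ ℤ[T]` all of whose complex roots have absolute value `q_v^{-i/2}`
(reciprocal roots of absolute value `q_v^{i/2}`) such that, for **every** prime `ℓ` with
`v ∤ ℓ`, `Hⁱ_ℓ(X)` is unramified at `v` and `det(1 - F_v T | Hⁱ_ℓ(X)) = P_v(T)` in `ℚ_ℓ[T]`. [folklore] -/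
def EllIndependenceStatement (E : ∀ (ℓ : ℕ) [Fact ℓ.Prime], Literature.AlgebraicGeometry.Motives.EtaleRealization K ℓ) : Prop :=
  ∀ ⦃n : ℕ⦄ ⦃X : Literature.AlgebraicGeometry.Motives.SchemeOver K⦄, Literature.AlgebraicGeometry.Motives.IsSmoothProjective n X →
    ∀ (i : ℕ) (v : HeightOneSpectrum (𝓞 K)), Literature.AlgebraicGeometry.Motives.HasGoodReductionAt X n v →
      ∃ Pv : ℤ[X],
        (∀ z : ℂ, (Pv.map (Int.castRingHom ℂ)).IsRoot z →
          ‖z‖ = (v.residueCard : ℝ) ^ (-(i : ℝ) / 2)) ∧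
        ∀ (ℓ : ℕ) [Fact ℓ.Prime], (ℓ : 𝓞 K) ∉ v.asIdeal →
          ((E ℓ).galoisRep X i).IsUnramifiedAt v ∧
            Pv.map (Int.castRingHom ℚ_[ℓ]) = (E ℓ).localEulerFactorAt X i v

end GoodReduction

/-! ### lang.S35: the Fontaine–Mazur conjecture -/

section FontaineMazur

/-- The **subquotient representation** `N₁ / (N₁ ∩ N₂)` of a representation `τ` of `G` on `W`
attached to two `G`-stable submodules `N₁, N₂` (Mathlib `Subrepresentation`; intended use
`N₂ ≤ N₁`): the quotient (Mathlib `Representation.quotient`) of the restriction of `τ` to `N₁`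
(`Subrepresentation.toRepresentation`) by the pull-back of `N₂` along `N₁ ↪ W`, which is
`G`-stable since `N₂` is. Mathlib has sub- and quotient representations but no subquotient.
Ref: Fontaine–Mazur 1995, §1 ("subquotient"); Curtis–Reiner, *Methods of Representation
Theory* I, §1. [cite: FontaineMazur1995, §1 ("subquotient"] -/
def subquotientRep {k G W : Type*} [Ring k] [Monoid G] [AddCommGroup W] [Module k W]
    {τ : Representation k G W} (N₁ N₂ : Subrepresentation τ) :
    Representation k G (N₁.toSubmodule ⧸ N₂.toSubmodule.comap N₁.toSubmodule.subtype) :=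
  N₁.toRepresentation.quotient (N₂.toSubmodule.comap N₁.toSubmodule.subtype)
    fun g _ hx ↦ N₂.apply_mem_toSubmodule g hx

/-- The subquotient representation acts on the class of `x ∈ N₁` by the class of `τ g x`. [folklore] -/
@[simp] theorem subquotientRep_apply_mk {k G W : Type*} [Ring k] [Monoid G] [AddCommGroup W]
    [Module k W] {τ : Representation k G W} (N₁ N₂ : Subrepresentation τ) (g : G)
    (x : N₁.toSubmodule) :
    subquotientRep N₁ N₂ g (Submodule.Quotient.mk x) =
      Submodule.Quotient.mk (N₁.toRepresentation g x) :=
  rfl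

variable (E : ∀ (ℓ : ℕ) [Fact ℓ.Prime], Literature.AlgebraicGeometry.Motives.EtaleRealization K ℓ)

/-- **lang.S35** (Fontaine–Mazur 1995, §1: "comes from geometry"). The `ℓ`-adic Galois
representation `ρ : Γ_K → GL(M)` *comes from geometry* (w.r.t. the étale realizations `E`) if
there are a smooth projective variety `X` of some dimension `n` over `K`, a degree `i`, a Tate
twist `j : ℤ` and `Γ_K`-stable subspaces `N₂ ≤ N₁` of `Hⁱ_ℓ(X)(j)`
(`(E ℓ).galoisRepTwist X i j`, Mathlib `Subrepresentation`) such that `ρ` is isomorphic, as a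
representation of `Γ_K` (Mathlib `Representation.Equiv`), to the subquotient `N₁ / N₂`
(`subquotientRep`). Coefficients are `ℚ_ℓ` rather than `ℚ̄_ℓ` (module docstring). [cite: FontaineMazur1995, §1: "comes from geometry"] -/
def ComesFromGeometry {ℓ : ℕ} [Fact ℓ.Prime] {M : Type w'} [AddCommGroup M] [Module ℚ_[ℓ] M]
    [TopologicalSpace M] (ρ : GaloisRepresentations.GaloisRep K ℚ_[ℓ] M) : Prop :=
  ∃ (n : ℕ) (X : Literature.AlgebraicGeometry.Motives.SchemeOver K) (_ : Literature.AlgebraicGeometry.Motives.IsSmoothProjective n X) (i : ℕ) (j : ℤ)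
    (N₁ N₂ : Subrepresentation ((E ℓ).galoisRepTwist X i j).toRepresentation),
    N₂ ≤ N₁ ∧ Nonempty (ρ.toRepresentation.Equiv (subquotientRep N₁ N₂))

/-- **lang.S35** (the Fontaine–Mazur conjecture; Fontaine–Mazur 1995, §1, Conjecture 1).
Relative to étale realizations `E ℓ` (all primes `ℓ`) and period-ring data `𝔅 ℓ v` (intended:
`B_dR` of `K_v`, together with the missing Mathlib instance `Algebra ℚ_[ℓ] K_v`) at the places
`v ∣ ℓ`: every irreducible (Mathlib `Representation.IsIrreducible`) finite-dimensional
continuous `ℓ`-adic representation `ρ : Γ_K → GL(M)` which is *geometric* — unramified at all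
but finitely many places and de Rham at every `v ∣ ℓ` (accepted G09 `GaloisRep.IsGeometric`) —
comes from geometry (`ComesFromGeometry`), i.e. is a subquotient of some `Hⁱ_ℓ(X)(j)`.
`M` carries the `ℚ_ℓ`-module topology (`IsModuleTopology`, OUTLINE D1 of G09). Deviation:
`ℚ_ℓ`- rather than `ℚ̄_ℓ`-coefficients (module docstring). An open conjecture: a `Prop`. [cite: FontaineMazur1995, §1  Conjecture 1] -/
def FontaineMazurConjecture
    (𝔅 : ∀ (ℓ : ℕ) [Fact ℓ.Prime] (v : HeightOneSpectrum (𝓞 K)), ((ℓ : ℕ) : 𝓞 K) ∈ v.asIdeal →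
      Σ' (_ : Algebra ℚ_[ℓ] (v.adicCompletion K)),
        GaloisRepresentations.PeriodRingData.{0, 0, 0, w} (absoluteGaloisGroup (v.adicCompletion K)) ℚ_[ℓ]
          (v.adicCompletion K)) : Prop :=
  ∀ (ℓ : ℕ) [Fact ℓ.Prime] (M : Type) [AddCommGroup M] [Module ℚ_[ℓ] M] [TopologicalSpace M]
    [IsModuleTopology ℚ_[ℓ] M] [Module.Finite ℚ_[ℓ] M] (ρ : GaloisRepresentations.GaloisRep K ℚ_[ℓ] M),
    ρ.toRepresentation.IsIrreducible → GaloisRepresentations.GaloisRep.IsGeometric (𝔅 ℓ) ρ → ComesFromGeometry E ρ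

end FontaineMazur

end Literature.NumberTheory.Automorphic

end
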